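import Summits.BirchSwinnertonDyer.BirchSwinnertonDyer.Theorems.ManinLocalTwoThreeMazurManinConstantOddPrimes
import Summits.BirchSwinnertonDyer.BirchSwinnertonDyer.Theorems.ManinLocalTwoThreeAbbesUllmoCesnaviciusManinConstant
import Summits.BirchSwinnertonDyer.BirchSwinnertonDyer.Theses.ShiftedKolyvaginAtInertTwo
import HarnessLib

set_option autoImplicit false
-- the sub-problem namespace `Summit.BirchSwinnertonDyer.BirchSwinnertonDyer` duplicates a component by design (D-0017)
set_option linter.dupNamespace false

/-!
# Route ShiftedKolyvaginAtInertTwo, support item `ManinConstantPrimewisePrints` (stmt-BirchSwinnertonDyer-27273), closed by name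

The item is VERBATIM the conjunction of the three prime-by-prime Manin-constant print facts in lattice rendering:
Mazur 1978 Cor. 4.1 (`mazur_not_dvd_maninConstant_of_odd`) ∧ Abbes–Ullmo 1996 Thm. A
(`abbesUllmo_not_dvd_maninConstant_of_not_dvd_level`) ∧ Česnavičius 2018 Thm. 1.2, case `2 ∥ N`
(`cesnavicius_not_two_dvd_maninConstant_of_two_dvd_level`).  All three are tree theorems
(`mazur_not_dvd_maninConstant_of_odd_holds`, p828097; `abbesUllmo_not_dvd_maninConstant_of_not_dvd_level_holds` and
`cesnavicius_not_two_dvd_maninConstant_of_two_dvd_level_holds`, p828339): Stevens' inclusion `Λ₁(f) ⊆ Λ_W` from the Unbounded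
Denominators theorem [CalegariDimitrovTang2025, Thm. 1.0.1] with the conjugation obstruction (odd `p`), and the half-index / Kummer-value
road with Stevens 1982 Thm. 1.3.1 (b) (`StevensGalois.naturalTes75_holds`) at `p = 2` — cell bsd-f2-manin's roads.

DEPENDENCY / WORDING OF RECORD (director-bsd (848)(C), (849)(1)(4)).  The proof term rests on the in-tree term
`calegariDimitrovTang2025_unboundedDenominators_holds` — UDC-dependent; audit (P†) pending; «kernel-closed (UDC-dependent, audit pending)»,
never «unconditional».  AS-TYPED vs PRINT: «=» print (three lattice renderings, each weaker than its source).  BSD is not proved by this;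
Manin's conjecture is not proved by this; nothing here is an announcement.
[cite: Mazur1978, Cor. 4.1] [cite: AbbesUllmo1996, Thm. A] [cite: Cesnavicius2018, Thm. 1.2] [cite: CalegariDimitrovTang2025, Thm. 1.0.1]
-/

namespace Summit.BirchSwinnertonDyer.BirchSwinnertonDyer.Theorems

/-- **Support item `ManinConstantPrimewisePrints` (stmt-BirchSwinnertonDyer-27273), proved by name**: the triple of the tree theorems
for Mazur 1978 Cor. 4.1, Abbes–Ullmo 1996 Thm. A and Česnavičius 2018 Thm. 1.2 (`2 ∥ N`).  UDC-dependent; audit (P†) pending; BSD is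
NOT proved by this. [cite: Mazur1978, Cor. 4.1] [cite: AbbesUllmo1996, Thm. A] [cite: Cesnavicius2018, Thm. 1.2] [cite: CalegariDimitrovTang2025, Thm. 1.0.1] -/
theorem ShiftedKolyvaginAtInertTwo.ManinConstantPrimewisePrints_proof :
    Summit.BirchSwinnertonDyer.BirchSwinnertonDyer.Theses.ShiftedKolyvaginAtInertTwo.ManinConstantPrimewisePrints :=
  ⟨mazur_not_dvd_maninConstant_of_odd_holds, abbesUllmo_not_dvd_maninConstant_of_not_dvd_level_holds,
    cesnavicius_not_two_dvd_maninConstant_of_two_dvd_level_holds⟩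

end Summit.BirchSwinnertonDyer.BirchSwinnertonDyer.Theorems
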